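import Summits.NavierStokesRegularity.NavierStokesRegularity.Theses.AngularGalerkinLadder
import Summits.NavierStokesRegularity.NavierStokesRegularity.Theorems.NoOverheating.Negative.LadderLimitExposed
import HarnessLib

/-!
# KJ-66 — TRAVELLING-WAVE rung profiles are trivial, and window sequences cannot be asymptotically
# travelling (route `AngularGalerkinLadder`, cruxes K1 `RungBlowupCofinal` / K2 `NoOverheating`;
# refuter lineage, Negative lane)

Stratum (S26), the Galilean companion of (S11b)/(S20) (steady / asymptotically steady):

* PROFILE-level (any `C₀`, any rotation, any factor): a field with Type-I decay
  `‖u(t, x)‖ ≤ C/(‖x‖ + √(−t))` that is a travelling wave on the past, `u(t, x) = U(x − t b)`, is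
  identically zero there — follow the wave back in time: `U(y) = u(s, y + s b)` is bounded by
  `C/√(−s)` for every `s < 0` (`eq_zero_of_travelling_of_hasTypeIDecay`); so no rung profile
  witnessing `RungIsSingular`, and no window profile, is a travelling wave
  (`not_nontrivial_rungProfile_of_travelling`, `no_windowProfile_travelling`);
* SEQUENCE-level (any `C₀`, any rotations, any window): no admissible window sequence is
  ASYMPTOTICALLY travelling with a velocity `b`,
  `uₙ(t, x + t b) − uₙ(s, x + s b) → 0` pointwise (`s, t < 0`) — the ladder limit (pointwise
  convergence of slices suffices) is a travelling wave with Type-I decay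
  (`no_windowSequence_asymptoticallyTravelling`); (S20) is `b = 0`.

READING FOR THE CIRCUIT: Galilean drift buys nothing — a supply profile can be neither a
travelling wave nor asymptotically one along the ladder.  No `kit`.
[cite: KochNadirashviliSereginSverak2009, §6 (Type-I ancient solutions); Lemma 6.1] -/

namespace Summit.NavierStokesRegularity.AngularGalerkinLadderTravellingWaveProfilesExcluded

open Set Filter MeasureTheory Topology Function
open Literature.Analysis Literature.Analysis.FluidPDE
open Summit.NavierStokesRegularity.FluidComputer
open Summit.NavierStokesRegularity.FluidComputer.AngularLadder
open Summit.NavierStokesRegularity.NavierStokesRegularity.Theses.AngularGalerkinLadder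
open Summit.NavierStokesRegularity.AngularGalerkinLadderLadderLimit

/-! ## §1 A travelling wave with Type-I decay vanishes -/

/-- **Travelling + Type-I decay ⇒ zero.**  If `‖v(t, x)‖ ≤ C/(‖x‖ + √(−t))` for `t < 0` and
`v(t, x) = U(x − t b)` on the past, then `v ≡ 0` on the past: `v(t, x) = v(s, x + (s − t) b)` for
every `s < 0`, whose norm is at most `C/√(−s) → 0` as `s → −∞`. [folklore] -/
theorem eq_zero_of_travelling_of_hasTypeIDecay
    {v : ℝ → EuclideanSpace ℝ (Fin 3) → EuclideanSpace ℝ (Fin 3)} {C : ℝ} (hTI : HasTypeIDecay C v)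
    {U : EuclideanSpace ℝ (Fin 3) → EuclideanSpace ℝ (Fin 3)} {b : EuclideanSpace ℝ (Fin 3)}
    (htrav : ∀ t < 0, ∀ x, v t x = U (x - t • b)) : ∀ t < 0, ∀ x, v t x = 0 := by
  intro t ht x
  by_contra hx
  have hε : 0 < ‖v t x‖ := norm_pos_iff.2 hx
  set A : ℝ := |C| / ‖v t x‖ + 1 with hA
  have hA0 : 0 < A := by positivity
  have hs : -(A ^ 2) < 0 := by have := pow_pos hA0 2; linarith
  -- the same wave value, read at time `s = −A²` and position `x + (s − t) b`
  set y : EuclideanSpace ℝ (Fin 3) := x + (-(A ^ 2) - t) • b with hy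
  have hval : v (-(A ^ 2)) y = v t x := by
    rw [htrav _ hs, htrav t ht x, hy]
    congr 1
    rw [sub_smul, neg_smul]
    abel
  have h1 := hTI (-(A ^ 2)) hs y
  rw [neg_neg, Real.sqrt_sq hA0.le, hval] at h1
  have hpos : 0 < ‖y‖ + A := by positivity
  have h2 := (le_div_iff₀ hpos).1 h1
  have h3 : ‖v t x‖ * A ≤ C := by nlinarith [norm_nonneg y, hε]
  have h4 : ‖v t x‖ * A = |C| + ‖v t x‖ := by rw [hA]; field_simp
  linarith [le_abs_self C]

/-! ## §2 (S26) PROFILE-level: travelling-wave rung profiles are trivial -/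

section Profile

variable {L : ℕ} {C₀ c : ℝ} {R : EuclideanSpace ℝ (Fin 3) ≃ₗᵢ[ℝ] EuclideanSpace ℝ (Fin 3)}
  {u : ℝ → EuclideanSpace ℝ (Fin 3) → EuclideanSpace ℝ (Fin 3)}
  {p : ℝ → EuclideanSpace ℝ (Fin 3) → ℝ}
  {d : ℝ → EuclideanSpace ℝ (Fin 3) → EuclideanSpace ℝ (Fin 3)}

/-- **(S26) A travelling-wave rung profile vanishes on the past** (any `C₀`, any rotation, any
factor; only the Type-I decay is used). -/
theorem rungProfile_eq_zero_of_travelling (hP : IsRungProfile L C₀ c R u p d)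
    {U : EuclideanSpace ℝ (Fin 3) → EuclideanSpace ℝ (Fin 3)} {b : EuclideanSpace ℝ (Fin 3)}
    (htrav : ∀ t < 0, ∀ x, u t x = U (x - t • b)) : ∀ t < 0, ∀ x, u t x = 0 :=
  eq_zero_of_travelling_of_hasTypeIDecay hP.hasTypeIDecay htrav

/-- **(S26) for K1's witnesses**: a travelling-wave rung profile is not a `RungIsSingular`
witness. -/
theorem not_nontrivial_rungProfile_of_travelling (hP : IsRungProfile L C₀ c R u p d)
    {U : EuclideanSpace ℝ (Fin 3) → EuclideanSpace ℝ (Fin 3)} {b : EuclideanSpace ℝ (Fin 3)}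
    (htrav : ∀ t < 0, ∀ x, u t x = U (x - t • b)) : ¬ ∃ t < 0, ∃ x, u t x ≠ 0 :=
  fun ⟨t, ht, x, hx⟩ => hx (rungProfile_eq_zero_of_travelling hP htrav t ht x)

/-- **(S26) for K2's windows**: no window profile (`0 < δ`) is a travelling wave. -/
theorem no_windowProfile_travelling {cmin cmax δ ε : ℝ} (hδ : 0 < δ)
    (hW : IsWindowProfile L C₀ cmin cmax δ ε c R u p d)
    {U : EuclideanSpace ℝ (Fin 3) → EuclideanSpace ℝ (Fin 3)} {b : EuclideanSpace ℝ (Fin 3)}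
    (htrav : ∀ t < 0, ∀ x, u t x = U (x - t • b)) : False := by
  obtain ⟨hP, -, -, ⟨x₀, hx₀⟩, -⟩ := hW
  rw [rungProfile_eq_zero_of_travelling hP htrav (-1) (by norm_num) x₀, norm_zero] at hx₀
  exact absurd hx₀ (not_le.2 hδ)

end Profile

/-! ## §3 (S26) SEQUENCE-level: no asymptotically travelling window sequence -/

variable {C₀ cmin cmax δ : ℝ} {L : ℕ → ℕ} {ε c : ℕ → ℝ}
  {R : ℕ → (EuclideanSpace ℝ (Fin 3) ≃ₗᵢ[ℝ] EuclideanSpace ℝ (Fin 3))}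
  {u : ℕ → ℝ → EuclideanSpace ℝ (Fin 3) → EuclideanSpace ℝ (Fin 3)}
  {p : ℕ → ℝ → EuclideanSpace ℝ (Fin 3) → ℝ}
  {d : ℕ → ℝ → EuclideanSpace ℝ (Fin 3) → EuclideanSpace ℝ (Fin 3)}

/-- **(S26) No admissible window sequence is asymptotically a travelling wave.**  `1 < cmin`,
`0 < δ`, `εₙ → 0`, window rung profiles with constant `C₀` — ANY `C₀`, ANY rotations, ANY window
— and a velocity `b` with `uₙ(t, x + t b) − uₙ(s, x + s b) → 0` pointwise (`s, t < 0`) are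
contradictory: the ladder limit `v` (`exists_ladderLimit`, pointwise convergence of slices)
satisfies `v(t, x + t b) = v(s, x + s b)`, i.e. is the travelling wave
`U(y) = v(−1, y − b)`, and has Type-I decay — so it vanishes, against non-triviality.
[cite: KochNadirashviliSereginSverak2009, Lemma 6.1 (limits of rescaled solutions); §6] -/
theorem no_windowSequence_asymptoticallyTravelling (hcmin : 1 < cmin) (hδ : 0 < δ)
    (hε : Tendsto ε atTop (𝓝 0))
    (hW : ∀ n, IsWindowProfile (L n) C₀ cmin cmax δ (ε n) (c n) (R n) (u n) (p n) (d n))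
    (b : EuclideanSpace ℝ (Fin 3))
    (hdef : ∀ s < 0, ∀ t < 0, ∀ x,
      Tendsto (fun n => u n t (x + t • b) - u n s (x + s • b)) atTop (𝓝 0)) : False := by
  obtain ⟨φ, c', R', v, hφ, -, hptw, -, -, -, -, -, -, hTI, hnz⟩ :=
    exists_ladderLimit hcmin hδ hε hW
  -- the limit is Galilean-steady: `v(t, x + t b) = v(s, x + s b)`
  have hgal : ∀ s < 0, ∀ t < 0, ∀ x, v t (x + t • b) = v s (x + s • b) := by
    intro s hs t ht x
    have h0 : v t (x + t • b) - v s (x + s • b) = 0 :=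
      tendsto_nhds_unique ((hptw t ht _).sub (hptw s hs _))
        ((hdef s hs t ht x).comp hφ.tendsto_atTop)
    exact sub_eq_zero.1 h0
  -- hence a travelling wave with profile `U(y) = v(−1, y − b)`
  have htrav : ∀ t < 0, ∀ x, v t x = (fun y => v (-1) (y - b)) (x - t • b) := by
    intro t ht x
    have h := hgal (-1) (by norm_num) t ht (x - t • b)
    simp only [sub_add_cancel, neg_smul, one_smul] at h
    simpa [sub_eq_add_neg] using h
  have hz :=
    eq_zero_of_travelling_of_hasTypeIDecay hTI (U := fun y => v (-1) (y - b)) (b := b) htrav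
  exact hnz fun t ht => Eventually.of_forall fun x => by simpa using hz t ht x

/-- **(S26) in census form.** -/
theorem no_windowSequence_asymptoticallyTravelling_census (hcmin : 1 < cmin) (hδ : 0 < δ)
    (hε : Tendsto ε atTop (𝓝 0))
    (hW : ∀ n, IsWindowProfile (L n) C₀ cmin cmax δ (ε n) (c n) (R n) (u n) (p n) (d n)) :
    ¬ (∃ b : EuclideanSpace ℝ (Fin 3), ∀ s < 0, ∀ t < 0, ∀ x,
        Tendsto (fun n => u n t (x + t • b) - u n s (x + s • b)) atTop (𝓝 0)) :=
  fun ⟨b, hdef⟩ => no_windowSequence_asymptoticallyTravelling hcmin hδ hε hW b hdef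

end Summit.NavierStokesRegularity.AngularGalerkinLadderTravellingWaveProfilesExcluded
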